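/- Copyright: the b2b-balaban cell (near-miss cell 7), T⁴-continuum fan-out, lineage t4-ne7b-formalise-leaf-02 (NE7b
CRUX team (2), leaf prover 02), gen 108 — sanity companion of the (A3) module J2b candidate (announced IR-99-3); files only if wanted.  Released
under the licence of the surrounding project. -/
import Summits.QuantumFields.BalabanUV.T4Continuum.Support.B16HistoryReprReadCausal
import Summits.QuantumFields.BalabanUV.T4Continuum.Support.B16HistoryReprReadSanity

/-!
# Sanity for (A3) module J2b: the hypotheses of `histRead_tower_of_hw` are JOINTLY INHABITED (non-vacuity) on a
decided toy — J1's history-blind tower `× 1∕2` ∕ `× 1∕3` on one-point configuration spaces with `ρ₀ ≡ 1`, `B ≡ 1`,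
and THE EMPTY STEP READING (no choice names a region or a cube; flow `L = 2`, `s ≡ 0`, `R ≡ Rm ≡ 1`): the per-step
envelope `wStep` IS `1` (no component is ever formed), the per-step display `hw` reads `1∕2, 1∕3 ≤ 1`, and `HistRead`
for the induced reading is OBTAINED from the theorem (kernel-decided; says NOTHING about Bałaban's objects).

HONEST.  [folklore]; nothing printed is asserted; BY-NAME EFFECT ON THE WALL: NONE; NE7b NOT PRINTED ∕ NOT PROVED; spine
0∕9; rung (B)+1 finite T⁴ — NOT infinite volume, NOT the mass gap, NOT Clay.  HONEST DEPENDENCY (cell): continuum YM on T⁴ ⇐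
BetaPertH ∧ nine spine estimates (0/9 proved); BetaPertH ⇐ (D1) ∧ (D4) ∧ CAP+tail; G-an2-4 gates asym, D1 and NE2/3/4.
-/

open Finset MeasureTheory
open Literature.MathematicalPhysics.QuantumFieldTheory.Balaban1983to89
open Summit.QuantumFields.BalabanUV.T4Continuum.HistoryGenealogyRealise
open Summit.QuantumFields.BalabanUV.T4Continuum.HistoryGenealogyInstantiate

namespace Summit.QuantumFields.BalabanUV.T4Continuum.B16HistoryReprReadCausal.Sanity

open Summit.QuantumFields.BalabanUV.T4Continuum.B16HistoryIndexedRepr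
open Summit.QuantumFields.BalabanUV.T4Continuum.B16HistoryReprChain
open Summit.QuantumFields.BalabanUV.T4Continuum.B16HistoryReprInstance
open Summit.QuantumFields.BalabanUV.T4Continuum.B16HistoryReprRead
open Summit.QuantumFields.BalabanUV.T4Continuum.B16HistoryReprRead.Sanity
open Summit.QuantumFields.BalabanUV.T4Continuum.B16HistoryReprReadCausal

noncomputable section

/-- THE EMPTY STEP READING (dimension `1`): no choice names a region or a new-field cube; flow `L = 2`, `s ≡ 0`,
`R ≡ Rm ≡ 1`; classes `0`. [folklore] -/
def 𝒮₀ : StepReading Bool 1 where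
  L := 2
  s _ _ := 0
  R _ _ := 1
  Rm _ _ _ := 1
  κ _ _ := 0
  ν _ _ _ _ := ∅
  φ _ _ _ _ := ∅

/-- with no region ever named, the per-step envelope is the empty product `1` [folklore] -/
theorem wStep_empty (fB : ℕ → ℕ → ℕ → Lab 1 → ℝ) (fR : ℕ → ℕ → ℝ) (Λ : ℕ → ℕ → ℝ) (K j : ℕ) (g : Fin j → Bool)
    (p : Bool) : 𝒮₀.wStep fB fR Λ K j g p = 1 := by
  unfold StepReading.wStep
  rw [(𝒮₀.runPartial K (j + 1) (Fin.snoc g p)).comp_histM_eq_empty_of_N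
    (𝒮₀.Nof_eq_empty fun _ => rfl) (j + 1), Finset.prod_empty]

/-- **NON-VACUITY: `HistRead` FOR THE TOY WITH THE EMPTY STEP READING FROM `histRead_tower_of_hw`** — every
hypothesis discharged by decided arithmetic (unit factor values; `hw`: `1∕2, 1∕3 ≤ 1 = wStep`; `|1| ≤ 1`; the
small choice names nothing by `rfl`). [folklore] -/
example : HistRead (𝒮₀.reading Tfam p₀)
    (factorsOf Tfam p₀ B (fun _ _ _ _ => 1) (fun _ _ => 1) (fun _ _ => 1) (fun _ _ => le_rfl)
      (𝒮₀.wStep (fun _ _ _ _ => 1) (fun _ _ => 1) (fun _ _ => 1)))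
    (reprFam Tfam p₀ ρ₀ (fun _ _ => trivial) (fun _ _ _ => zero_le_one) B (fun _ _ => zero_lt_one)) 1 0 :=
  𝒮₀.histRead_tower_of_hw Tfam p₀ ρ₀ (fun _ _ => trivial) (fun _ _ _ => zero_le_one) B (fun _ _ => zero_lt_one)
    (fun _ _ _ _ => 1) (fun _ _ => 1) (fun _ _ => 1) (fun _ _ => le_rfl)
    (fun _ _ _ _ => zero_le_one) (fun _ _ => zero_le_one)
    (fun K _ j g p x => by
      rw [wStep_empty]
      exact (hw_toy K j g p x).trans (by
        show (if p then 1 / 2 else 1 / 3 : ℝ) ≤ 1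
        split_ifs <;> norm_num))
    (fun K t _ _ y => by
      show |(1 : ℝ)| ≤ 1
      rw [abs_one])
    (fun _ _ _ => rfl)

/-- … and M2-B's per-term binder `NewOK` holds for every run of the toy reading (vacuously: no region).
[folklore] -/
example (K : ℕ) (τ : HIndex.Idx (skelFam Tfam p₀)) : ((𝒮₀.reading Tfam p₀).inputOf.run K τ).NewOK :=
  𝒮₀.newOK_run Tfam p₀ (fun _ _ _ _ n hn => absurd hn (Finset.notMem_empty n)) K τ

end

end Summit.QuantumFields.BalabanUV.T4Continuum.B16HistoryReprReadCausal.Sanity
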